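import Mathlib
import HarnessLib
import Summits.NavierStokesRegularity.NavierStokesRegularity.Theorems.PoloidalWindowDoorLrcModEntireTwistingTHLocalScaling

/-!
# Route `PoloidalWindowDoor`, crux `PoloidalWindowRigidity` (stmt-19708) / item `LrcModEntire` (stmt-20428), line `sparse_energy` —
# the SOURCE-FREE local (TH)∩twisting statement: SCALING gauge (fourth normal-form step of v4.4; rotation in `…NormalFormR`)

Seat ns-poloidal-K2-p2 g9 (successor of the interim LEAD-of-record on 19708; file `--supports`).  Continues `…TwistingTHSparseNormalForm`
(non-umbilic + Galilean): K2-p2 g8's `…TwistingTHLocalRotation.localTHEmptyHypNF_of_rotation` (p607457) and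
`…TwistingTHLocalScaling.localTHEmptyHypNFR_of_scaling` (p607864) RE-RUN WITH THE EXPLICIT DATUM TRACKED.  The source-free rest-frame datum
`A = k(∂ₜμ − ∂_z²μ) − (k²/2)∂_zμ` (one real scalar `k`) is INVARIANT under the horizontal rotation about the base point (`μ`, `A` unchanged, the
rotation fixes the height: `galileanSF_of_rotationSF`, same `k`) and COVARIANT under the parabolic scaling `(s,y) ↦ (c²s, cy)`, `u ↦ c·u`,
`μ′(s,z) = μ(c²s,cz)`, `A′ = c³A(c²s,cz)` (`rotationSF_of_scalingSF`, `k ↦ c·k`).  Hence the chain (this file + `…TwistingTHSparseNormalForm` +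
`…TwistingTHSparse`):  hemptyHypSF_NFRS ⇒ hemptyHypSF_NFR ⇒ hemptyHypSF_NUG ⇒ hemptyHypSF_NU ⇒ hemptyHypSF ⇒ `stub_hyperbolicTH` / `stub_twisting ∩ (TH)`
ON K-SPARSE PROFILES, where **hemptyHypSF_NFRS** = K2-p2 g8's `hemptyHypNFRS` (gauge of record `u(p₀) = 0`, `∂₀u₂(p₀) = 0`, `∂₁u₂(p₀) = 1`, non-umbilic,
`μ < 0`, pins) with the A-hypothesis `∃ k : ℝ, ∀ p ∈ U, A p.1 (p.2 2) = k·(∂ₜμ − ∂_z²μ)(p) − (k²/2)·∂_zμ(p)` inserted after `μ(p₀) < 0` — the v4.4 text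
`stub_localTHEmptySFRS` up to the order of binders and the spelling `∃ k` (K2-p3 may register either spelling; the sign of the `k²` term is MINUS).

WHAT THIS IS NOT: not a proof of any stub and not a claim about Navier–Stokes — two reductions (bears_on LADDER-NS N0 via 19708/20428). [folklore]
-/

noncomputable section

-- the summit and its single sub-problem share the name (CONVENTIONS §1), as in every Theorems file
set_option linter.dupNamespace false

namespace Summit.NavierStokesRegularity.NavierStokesRegularity.Theorems.PoloidalWindowDoorLrcModEntireTwistingTHSparseNormalFormRS

open Set Function Filter Topology Metric
open scoped RealInnerProductSpace InnerProductSpace Laplacian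
open Literature.Analysis Literature.Analysis.FluidPDE
open Summit.NavierStokesRegularity.NavierStokesRegularity.Theorems.PoloidalWindowDoorLrcModEntireTHCertLetters
open Summit.NavierStokesRegularity.NavierStokesRegularity.Theorems.PoloidalWindowDoorLrcModEntireTHCertDictionary
open Summit.NavierStokesRegularity.NavierStokesRegularity.Theorems.PoloidalWindowDoorLrcModEntireTwistingTHLocalScaling

/-! ### Step 4: scaling gauge `∂₁u₂(p₀) = 1` (the datum scales, `k ↦ c·k`) -/

/-- **`hemptyHypSF_NFR ⇐ hemptyHypSF_NFRS`** — the source-free rotated statement may assume `∂₁u₂(p₀) = 1` (parabolic scaling; p607864 verbatim, the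
explicit datum transforms with `k ↦ c·k`). [folklore] -/
theorem rotationSF_of_scalingSF
    (hS : ∀ (u : ℝ → EuclideanSpace ℝ (Fin 3) → EuclideanSpace ℝ (Fin 3)) (μ A : ℝ → ℝ → ℝ)
      (U : Set (ℝ × EuclideanSpace ℝ (Fin 3))) (p₀ : ℝ × EuclideanSpace ℝ (Fin 3)),
      IsOpen U → p₀ ∈ U →
      AnalyticOnNhd ℝ (Function.uncurry u) U →
      (∀ p ∈ U, AnalyticAt ℝ (Function.uncurry μ) (p.1, p.2 2)) →
      (∀ p ∈ U, AnalyticAt ℝ (Function.uncurry A) (p.1, p.2 2)) →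
      (∀ p ∈ U, fderiv ℝ (u p.1) p.2 (EuclideanSpace.single 0 1) 1 = fderiv ℝ (u p.1) p.2 (EuclideanSpace.single 1 1) 0) →
      (∀ p ∈ U, fderiv ℝ (u p.1) p.2 (EuclideanSpace.single 0 1) 0 + fderiv ℝ (u p.1) p.2 (EuclideanSpace.single 1 1) 1 +
        fderiv ℝ (u p.1) p.2 (EuclideanSpace.single 2 1) 2 = 0) →
      (∀ p ∈ U, ∀ b : Fin 3, b ≠ 2 →
        fderiv ℝ (u p.1) p.2 (EuclideanSpace.single 2 1) b =
          μ p.1 (p.2 2) * fderiv ℝ (u p.1) p.2 (EuclideanSpace.single b 1) 2) →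
      (∀ p ∈ U,
        (1 - μ p.1 (p.2 2)) *
            (deriv (fun s => u s p.2 2) p.1 + fderiv ℝ (fun y => u p.1 y 2) p.2 (u p.1 p.2)
              - Δ (fun y => u p.1 y 2) p.2) =
          A p.1 (p.2 2) + (deriv (fun s => μ s (p.2 2)) p.1 - deriv (deriv (μ p.1)) (p.2 2)) * u p.1 p.2 2
            + deriv (μ p.1) (p.2 2) / 2 * u p.1 p.2 2 ^ 2
            - 2 * deriv (μ p.1) (p.2 2) * fderiv ℝ (u p.1) p.2 (EuclideanSpace.single 2 1) 2) →
      fderiv ℝ (fun y => fderiv ℝ (u p₀.1) y (EuclideanSpace.single 2 1) 2) p₀.2 (EuclideanSpace.single 0 1) *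
            fderiv ℝ (u p₀.1) p₀.2 (EuclideanSpace.single 1 1) 2 -
          fderiv ℝ (fun y => fderiv ℝ (u p₀.1) y (EuclideanSpace.single 2 1) 2) p₀.2 (EuclideanSpace.single 1 1) *
            fderiv ℝ (u p₀.1) p₀.2 (EuclideanSpace.single 0 1) 2 ≠ 0 →
      μ p₀.1 (p₀.2 2) ≠ 0 → μ p₀.1 (p₀.2 2) ≠ 1 → deriv (μ p₀.1) (p₀.2 2) ≠ 0 →
      μ p₀.1 (p₀.2 2) < 0 →
      (∃ k : ℝ, ∀ p ∈ U, A p.1 (p.2 2) =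
        k * (deriv (fun s => μ s (p.2 2)) p.1 - deriv (deriv (μ p.1)) (p.2 2)) - k ^ 2 / 2 * deriv (μ p.1) (p.2 2)) →
      (fderiv ℝ (u p₀.1) p₀.2 (EuclideanSpace.single 0 1) 0 ≠ fderiv ℝ (u p₀.1) p₀.2 (EuclideanSpace.single 1 1) 1 ∨
        fderiv ℝ (u p₀.1) p₀.2 (EuclideanSpace.single 1 1) 0 ≠ 0) →
      u p₀.1 p₀.2 = 0 →
      fderiv ℝ (u p₀.1) p₀.2 (EuclideanSpace.single 0 1) 2 = 0 →
      fderiv ℝ (u p₀.1) p₀.2 (EuclideanSpace.single 1 1) 2 = 1 → False) :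
    ∀ (u : ℝ → EuclideanSpace ℝ (Fin 3) → EuclideanSpace ℝ (Fin 3)) (μ A : ℝ → ℝ → ℝ)
      (U : Set (ℝ × EuclideanSpace ℝ (Fin 3))) (p₀ : ℝ × EuclideanSpace ℝ (Fin 3)),
      IsOpen U → p₀ ∈ U →
      AnalyticOnNhd ℝ (Function.uncurry u) U →
      (∀ p ∈ U, AnalyticAt ℝ (Function.uncurry μ) (p.1, p.2 2)) →
      (∀ p ∈ U, AnalyticAt ℝ (Function.uncurry A) (p.1, p.2 2)) →
      (∀ p ∈ U, fderiv ℝ (u p.1) p.2 (EuclideanSpace.single 0 1) 1 = fderiv ℝ (u p.1) p.2 (EuclideanSpace.single 1 1) 0) →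
      (∀ p ∈ U, fderiv ℝ (u p.1) p.2 (EuclideanSpace.single 0 1) 0 + fderiv ℝ (u p.1) p.2 (EuclideanSpace.single 1 1) 1 +
        fderiv ℝ (u p.1) p.2 (EuclideanSpace.single 2 1) 2 = 0) →
      (∀ p ∈ U, ∀ b : Fin 3, b ≠ 2 →
        fderiv ℝ (u p.1) p.2 (EuclideanSpace.single 2 1) b =
          μ p.1 (p.2 2) * fderiv ℝ (u p.1) p.2 (EuclideanSpace.single b 1) 2) →
      (∀ p ∈ U,
        (1 - μ p.1 (p.2 2)) *
            (deriv (fun s => u s p.2 2) p.1 + fderiv ℝ (fun y => u p.1 y 2) p.2 (u p.1 p.2)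
              - Δ (fun y => u p.1 y 2) p.2) =
          A p.1 (p.2 2) + (deriv (fun s => μ s (p.2 2)) p.1 - deriv (deriv (μ p.1)) (p.2 2)) * u p.1 p.2 2
            + deriv (μ p.1) (p.2 2) / 2 * u p.1 p.2 2 ^ 2
            - 2 * deriv (μ p.1) (p.2 2) * fderiv ℝ (u p.1) p.2 (EuclideanSpace.single 2 1) 2) →
      fderiv ℝ (fun y => fderiv ℝ (u p₀.1) y (EuclideanSpace.single 2 1) 2) p₀.2 (EuclideanSpace.single 0 1) *
            fderiv ℝ (u p₀.1) p₀.2 (EuclideanSpace.single 1 1) 2 -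
          fderiv ℝ (fun y => fderiv ℝ (u p₀.1) y (EuclideanSpace.single 2 1) 2) p₀.2 (EuclideanSpace.single 1 1) *
            fderiv ℝ (u p₀.1) p₀.2 (EuclideanSpace.single 0 1) 2 ≠ 0 →
      μ p₀.1 (p₀.2 2) ≠ 0 → μ p₀.1 (p₀.2 2) ≠ 1 → deriv (μ p₀.1) (p₀.2 2) ≠ 0 →
      μ p₀.1 (p₀.2 2) < 0 →
      (∃ k : ℝ, ∀ p ∈ U, A p.1 (p.2 2) =
        k * (deriv (fun s => μ s (p.2 2)) p.1 - deriv (deriv (μ p.1)) (p.2 2)) - k ^ 2 / 2 * deriv (μ p.1) (p.2 2)) →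
      (fderiv ℝ (u p₀.1) p₀.2 (EuclideanSpace.single 0 1) 0 ≠ fderiv ℝ (u p₀.1) p₀.2 (EuclideanSpace.single 1 1) 1 ∨
        fderiv ℝ (u p₀.1) p₀.2 (EuclideanSpace.single 1 1) 0 ≠ 0) →
      u p₀.1 p₀.2 = 0 →
      fderiv ℝ (u p₀.1) p₀.2 (EuclideanSpace.single 0 1) 2 = 0 →
      0 < fderiv ℝ (u p₀.1) p₀.2 (EuclideanSpace.single 1 1) 2 → False := by
  intro u μ A U p₀ hU hp₀ hu hμ hA hpol hdiv hsh hE htw hm0 hm1 hmz hneg hSF hNU hrest hW0 hW1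
  obtain ⟨t₀, x₀⟩ := p₀
  dsimp only at hp₀ htw hm0 hm1 hmz hneg hNU hrest hW0 hW1
  -- the scale
  set c : ℝ := (Real.sqrt (fderiv ℝ (u t₀) x₀ (EuclideanSpace.single 1 1) 2))⁻¹ with hc
  have hcpos : 0 < c := inv_pos.mpr (Real.sqrt_pos.mpr hW1)
  have hc0 : c ≠ 0 := hcpos.ne'
  have hc2 : c * c * fderiv ℝ (u t₀) x₀ (EuclideanSpace.single 1 1) 2 = 1 := by
    rw [hc, ← sq, inv_pow, Real.sq_sqrt hW1.le]; field_simp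
  -- the scaled datum
  set u' : ℝ → EuclideanSpace ℝ (Fin 3) → EuclideanSpace ℝ (Fin 3) := fun s y => c • u (c ^ 2 * s) (c • y) with hu'
  set μ' : ℝ → ℝ → ℝ := fun s z => μ (c ^ 2 * s) (c * z) with hμ'
  set A' : ℝ → ℝ → ℝ := fun s z => c ^ 3 * A (c ^ 2 * s) (c * z) with hA'
  set U' : Set (ℝ × EuclideanSpace ℝ (Fin 3)) :=
    {p | ((c ^ 2 * p.1, c • p.2) : ℝ × EuclideanSpace ℝ (Fin 3)) ∈ U} with hU'
  have hτc : Continuous (fun p : ℝ × EuclideanSpace ℝ (Fin 3) =>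
      ((c ^ 2 * p.1, c • p.2) : ℝ × EuclideanSpace ℝ (Fin 3))) := by fun_prop
  have hτa : ∀ p : ℝ × EuclideanSpace ℝ (Fin 3), AnalyticAt ℝ (fun p : ℝ × EuclideanSpace ℝ (Fin 3) =>
      ((c ^ 2 * p.1, c • p.2) : ℝ × EuclideanSpace ℝ (Fin 3))) p := fun p =>
    (analyticAt_const.mul analyticAt_fst).prod (analyticAt_snd.const_smul (c := c))
  have hσa : ∀ q : ℝ × ℝ, AnalyticAt ℝ (fun q : ℝ × ℝ => ((c ^ 2 * q.1, c * q.2) : ℝ × ℝ)) q := fun q =>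
    (analyticAt_const.mul analyticAt_fst).prod (analyticAt_const.mul analyticAt_snd)
  have hU'o : IsOpen U' := hU.preimage hτc
  have hsm2 : ∀ y : EuclideanSpace ℝ (Fin 3), (c • y) 2 = c * y 2 := fun y => by simp
  have hT : c ^ 2 * (t₀ / c ^ 2) = t₀ := by field_simp
  have hX : c • c⁻¹ • x₀ = x₀ := by rw [smul_smul, mul_inv_cancel₀ hc0, one_smul]
  have hp₀' : ((t₀ / c ^ 2, c⁻¹ • x₀) : ℝ × EuclideanSpace ℝ (Fin 3)) ∈ U' := by
    show ((c ^ 2 * (t₀ / c ^ 2), c • c⁻¹ • x₀) : ℝ × EuclideanSpace ℝ (Fin 3)) ∈ U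
    rw [hT, hX]; exact hp₀
  -- analyticity of the scaled datum
  have hu'a : AnalyticOnNhd ℝ (uncurry u') U' := by
    intro p hp
    have h := (AnalyticAt.comp (g := uncurry u)
      (f := fun p : ℝ × EuclideanSpace ℝ (Fin 3) => ((c ^ 2 * p.1, c • p.2) : ℝ × EuclideanSpace ℝ (Fin 3)))
      (hu _ hp) (hτa p)).const_smul (c := c)
    refine h.congr (Eventually.of_forall fun q => ?_)
    obtain ⟨s, z⟩ := q; rfl
  have hμ'a : ∀ p ∈ U', AnalyticAt ℝ (uncurry μ') (p.1, p.2 2) := by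
    intro p hp
    have h1 : AnalyticAt ℝ (uncurry μ) (c ^ 2 * p.1, c * p.2 2) := by rw [← hsm2]; exact hμ _ hp
    have h := AnalyticAt.comp (g := uncurry μ) (f := fun q : ℝ × ℝ => ((c ^ 2 * q.1, c * q.2) : ℝ × ℝ))
      (x := (p.1, p.2 2)) h1 (hσa _)
    refine h.congr (Eventually.of_forall fun q => ?_)
    obtain ⟨s, ζ⟩ := q; rfl
  have hA'a : ∀ p ∈ U', AnalyticAt ℝ (uncurry A') (p.1, p.2 2) := by
    intro p hp
    have h1 : AnalyticAt ℝ (uncurry A) (c ^ 2 * p.1, c * p.2 2) := by rw [← hsm2]; exact hA _ hp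
    have h := (AnalyticAt.comp (g := uncurry A) (f := fun q : ℝ × ℝ => ((c ^ 2 * q.1, c * q.2) : ℝ × ℝ))
      (x := (p.1, p.2 2)) h1 (hσa _)).const_smul (c := c ^ 3)
    refine h.congr (Eventually.of_forall fun q => ?_)
    obtain ⟨s, ζ⟩ := q; simp [hA', smul_eq_mul]
  -- first derivatives of the scaled field: `c²` times the derivatives at the scaled point
  have hD : ∀ (s : ℝ) (y e : EuclideanSpace ℝ (Fin 3)) (i : Fin 3),
      fderiv ℝ (u' s) y e i = c * c * fderiv ℝ (u (c ^ 2 * s)) (c • y) e i := fun s y e i => by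
    rw [hu']; dsimp only
    rw [fderiv_const_smul_comp_smul_apply (u (c ^ 2 * s)) c c y, FunLike.coe_smul, Pi.smul_apply, PiLp.smul_apply,
      smul_eq_mul]
  have hslope : ∀ (s : ℝ) (y : EuclideanSpace ℝ (Fin 3)), μ' s (y 2) = μ (c ^ 2 * s) ((c • y) 2) := fun s y => by
    rw [hμ', hsm2]
  -- the kinematic identities transfer
  have hpol' : ∀ p ∈ U', fderiv ℝ (u' p.1) p.2 (EuclideanSpace.single 0 1) 1 =
      fderiv ℝ (u' p.1) p.2 (EuclideanSpace.single 1 1) 0 := fun p hp => by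
    rw [hD, hD, hpol _ hp]
  have hdiv' : ∀ p ∈ U', fderiv ℝ (u' p.1) p.2 (EuclideanSpace.single 0 1) 0 +
      fderiv ℝ (u' p.1) p.2 (EuclideanSpace.single 1 1) 1 + fderiv ℝ (u' p.1) p.2 (EuclideanSpace.single 2 1) 2 = 0 :=
    fun p hp => by
    have h := hdiv _ hp
    dsimp only at h
    rw [hD, hD, hD]
    linear_combination c * c * h
  have hsh' : ∀ p ∈ U', ∀ b : Fin 3, b ≠ 2 → fderiv ℝ (u' p.1) p.2 (EuclideanSpace.single 2 1) b =
      μ' p.1 (p.2 2) * fderiv ℝ (u' p.1) p.2 (EuclideanSpace.single b 1) 2 := fun p hp b hb => by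
    have h := hsh _ hp b hb
    dsimp only at h
    rw [hD, hD, hslope, h]; ring
  -- the scalar law transfers: E scales by `c³`
  have hE' : ∀ p ∈ U',
      (1 - μ' p.1 (p.2 2)) *
          (deriv (fun s => u' s p.2 2) p.1 + fderiv ℝ (fun y => u' p.1 y 2) p.2 (u' p.1 p.2)
            - Δ (fun y => u' p.1 y 2) p.2) =
        A' p.1 (p.2 2) + (deriv (fun s => μ' s (p.2 2)) p.1 - deriv (deriv (μ' p.1)) (p.2 2)) * u' p.1 p.2 2
          + deriv (μ' p.1) (p.2 2) / 2 * u' p.1 p.2 2 ^ 2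
          - 2 * deriv (μ' p.1) (p.2 2) * fderiv ℝ (u' p.1) p.2 (EuclideanSpace.single 2 1) 2 := by
    intro p hp
    obtain ⟨s, y⟩ := p
    have hq : ((c ^ 2 * s, c • y) : ℝ × EuclideanSpace ℝ (Fin 3)) ∈ U := hp
    have h := hE _ hq
    dsimp only at h ⊢
    rw [hsm2] at h
    -- time derivative
    have e1 : (fun σ => u' σ y 2) = fun σ => c * (fun t => u t (c • y) 2) (c ^ 2 * σ) := by
      funext σ; simp [hu']
    have e1' : deriv (fun σ => u' σ y 2) s = c * (c ^ 2 * deriv (fun t => u t (c • y) 2) (c ^ 2 * s)) := by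
      rw [e1, deriv_const_mul_field, deriv_comp_mul_left (c ^ 2) (fun t => u t (c • y) 2) s, smul_eq_mul]
    -- the slice `y ↦ u′₂(s,y) = c • u₂(c²s, c y)`
    have e2 : (fun z => u' s z 2) = fun z => c • (fun x => u (c ^ 2 * s) x 2) (c • z) := by
      funext z; simp [hu']
    have e3 : u' s y 2 = c * u (c ^ 2 * s) (c • y) 2 := by simp [hu']
    have e4 : fderiv ℝ (fun z => c • (fun x => u (c ^ 2 * s) x 2) (c • z)) y (u' s y) =
        c * c * c * fderiv ℝ (fun x => u (c ^ 2 * s) x 2) (c • y) (u (c ^ 2 * s) (c • y)) := by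
      rw [fderiv_const_smul_comp_smul_apply (fun x => u (c ^ 2 * s) x 2) c c y, FunLike.coe_smul, Pi.smul_apply, hu']
      dsimp only
      rw [map_smul, smul_eq_mul, smul_eq_mul]; ring
    have e5 : Δ (fun z => c • (fun x => u (c ^ 2 * s) x 2) (c • z)) y =
        c * c ^ 2 * Δ (fun x => u (c ^ 2 * s) x 2) (c • y) := by
      rw [laplacian_const_smul_comp_smul (fun x => u (c ^ 2 * s) x 2) c hc0 y, smul_eq_mul]
    -- slope derivatives
    have e6 : deriv (μ' s) (y 2) = c * deriv (μ (c ^ 2 * s)) (c * y 2) := by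
      rw [hμ']; dsimp only; rw [deriv_comp_mul_left c (μ (c ^ 2 * s)) (y 2), smul_eq_mul]
    have e7 : deriv (deriv (μ' s)) (y 2) = c * (c * deriv (deriv (μ (c ^ 2 * s))) (c * y 2)) := by
      have hf : deriv (μ' s) = fun z => c * deriv (μ (c ^ 2 * s)) (c * z) := by
        funext z; rw [hμ']; dsimp only; rw [deriv_comp_mul_left c (μ (c ^ 2 * s)) z, smul_eq_mul]
      rw [hf, deriv_const_mul_field, deriv_comp_mul_left c (deriv (μ (c ^ 2 * s))) (y 2), smul_eq_mul]
    have e8 : deriv (fun σ => μ' σ (y 2)) s = c ^ 2 * deriv (fun t => μ t (c * y 2)) (c ^ 2 * s) := by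
      have hf : (fun σ => μ' σ (y 2)) = fun σ => (fun t => μ t (c * y 2)) (c ^ 2 * σ) := by funext σ; simp [hμ']
      rw [hf, deriv_comp_mul_left (c ^ 2) (fun t => μ t (c * y 2)) s, smul_eq_mul]
    rw [e1', e2, e3, e4, e5, e6, e7, e8, hslope, hsm2, hD, hA']
    dsimp only
    linear_combination c ^ 3 * h
  -- the pins at `p₀′ = (t₀/c², c⁻¹x₀)`
  have hD₀ : ∀ (e : EuclideanSpace ℝ (Fin 3)) (i : Fin 3),
      fderiv ℝ (u' (t₀ / c ^ 2)) (c⁻¹ • x₀) e i = c * c * fderiv ℝ (u t₀) x₀ e i := fun e i => by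
    rw [hD, hT, hX]
  have hG₀ : ∀ e : EuclideanSpace ℝ (Fin 3),
      fderiv ℝ (fun y => fderiv ℝ (u' (t₀ / c ^ 2)) y (EuclideanSpace.single 2 1) 2) (c⁻¹ • x₀) e =
        c * c * c * fderiv ℝ (fun y => fderiv ℝ (u t₀) y (EuclideanSpace.single 2 1) 2) x₀ e := fun e => by
    have hfun : (fun y => fderiv ℝ (u' (t₀ / c ^ 2)) y (EuclideanSpace.single 2 1) 2) =
        fun y => (c * c) • (fun x => fderiv ℝ (u t₀) x (EuclideanSpace.single 2 1) 2) (c • y) := by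
      funext y; rw [hD, hT, smul_eq_mul]
    rw [hfun, fderiv_const_smul_comp_smul_apply (fun x => fderiv ℝ (u t₀) x (EuclideanSpace.single 2 1) 2) (c * c) c,
      FunLike.coe_smul, Pi.smul_apply, hX, smul_eq_mul]
  have hsl₀ : μ' (t₀ / c ^ 2) ((c⁻¹ • x₀) 2) = μ t₀ (x₀ 2) := by
    rw [hμ']; dsimp only; rw [hT, PiLp.smul_apply, smul_eq_mul, ← mul_assoc, mul_inv_cancel₀ hc0, one_mul]
  have hslz₀ : deriv (μ' (t₀ / c ^ 2)) ((c⁻¹ • x₀) 2) = c * deriv (μ t₀) (x₀ 2) := by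
    rw [hμ']; dsimp only
    rw [deriv_comp_mul_left c (μ (c ^ 2 * (t₀ / c ^ 2))) ((c⁻¹ • x₀) 2), hT, PiLp.smul_apply, smul_eq_mul, smul_eq_mul,
      ← mul_assoc, mul_inv_cancel₀ hc0, one_mul]
  -- the source-free datum scales: k ↦ c·k (μ′_t = c²μ_t, μ′_zz = c²μ_zz, μ′_z = cμ_z at the scaled point, A′ = c³A)
  have hSF' : ∃ k : ℝ, ∀ p ∈ U', A' p.1 (p.2 2) =
      k * (deriv (fun s => μ' s (p.2 2)) p.1 - deriv (deriv (μ' p.1)) (p.2 2)) - k ^ 2 / 2 * deriv (μ' p.1) (p.2 2) := by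
    obtain ⟨k, hk⟩ := hSF
    refine ⟨c * k, fun p hp => ?_⟩
    obtain ⟨s, y⟩ := p
    have hq : ((c ^ 2 * s, c • y) : ℝ × EuclideanSpace ℝ (Fin 3)) ∈ U := hp
    have h := hk _ hq
    dsimp only at h
    have e6 : deriv (μ' s) (y 2) = c * deriv (μ (c ^ 2 * s)) (c * y 2) := by
      rw [hμ']; dsimp only; rw [deriv_comp_mul_left c (μ (c ^ 2 * s)) (y 2), smul_eq_mul]
    have e7 : deriv (deriv (μ' s)) (y 2) = c * (c * deriv (deriv (μ (c ^ 2 * s))) (c * y 2)) := by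
      have hf : deriv (μ' s) = fun z => c * deriv (μ (c ^ 2 * s)) (c * z) := by
        funext z; rw [hμ']; dsimp only; rw [deriv_comp_mul_left c (μ (c ^ 2 * s)) z, smul_eq_mul]
      rw [hf, deriv_const_mul_field, deriv_comp_mul_left c (deriv (μ (c ^ 2 * s))) (y 2), smul_eq_mul]
    have e8 : deriv (fun σ => μ' σ (y 2)) s = c ^ 2 * deriv (fun t => μ t (c * y 2)) (c ^ 2 * s) := by
      have hf : (fun σ => μ' σ (y 2)) = fun σ => (fun t => μ t (c * y 2)) (c ^ 2 * σ) := by funext σ; simp [hμ']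
      rw [hf, deriv_comp_mul_left (c ^ 2) (fun t => μ t (c * y 2)) s, smul_eq_mul]
    dsimp only
    rw [e6, e7, e8, hA']
    dsimp only
    rw [hsm2] at h
    rw [h]
    ring
  refine hS u' μ' A' U' (t₀ / c ^ 2, c⁻¹ • x₀) hU'o hp₀' hu'a hμ'a hA'a hpol' hdiv' hsh' hE' ?_ ?_ ?_ ?_ ?_ hSF' ?_ ?_ ?_ ?_
  · -- twist scales by `c⁵`
    dsimp only
    rw [hG₀, hG₀, hD₀, hD₀]
    intro h
    apply htw
    have h5 : (c * c * c) * (c * c) ≠ 0 := by positivity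
    refine (mul_eq_zero.mp ?_).resolve_left h5
    linear_combination h
  · dsimp only; rw [hsl₀]; exact hm0
  · dsimp only; rw [hsl₀]; exact hm1
  · dsimp only; rw [hslz₀]; exact mul_ne_zero hc0 hmz
  · dsimp only; rw [hsl₀]; exact hneg
  · -- the non-umbilic pin scales by `c²`
    dsimp only
    rw [hD₀, hD₀, hD₀]
    have hcc : c * c ≠ 0 := mul_ne_zero hc0 hc0
    rcases hNU with hne | hne
    · left; intro h; exact hne (mul_left_cancel₀ hcc h)
    · right; intro h; exact hne ((mul_eq_zero.mp h).resolve_left hcc)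
  · -- rest point
    dsimp only; rw [hu']; dsimp only; rw [hT, hX, hrest, smul_zero]
  · dsimp only; rw [hD₀, hW0, mul_zero]
  · dsimp only; rw [hD₀]; exact hc2

end Summit.NavierStokesRegularity.NavierStokesRegularity.Theorems.PoloidalWindowDoorLrcModEntireTwistingTHSparseNormalFormRS

end
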